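import Summits.AtomisticToContinuum.Crystallization.Theorems.FrustratedLawDichotomyCoherentFloorComplete
import Summits.AtomisticToContinuum.Crystallization.Theorems.FrustratedLawDichotomyCellData

/-!
# FrustratedLawDichotomy · crux `AperiodicFrustratedLawGap` (stmt-AtomisticToContinuum-27623) — CELL-SOUND I′: THE LABEL FRAME OVER COMPLETE TEMPLATES
(KFILE amendment E, critic r1861 (A)(E1) «wrappers re-thread by deleting the binder — hand-2, additive primed variants»; decomp-a2c hand-2 g48)

TEMPLATE-COMPLETENESS (lens-5 FINDING l.9752, ruled r1861): the class-A door (244) `…CoherentFloor.certFloor_le_two_mul_rootEnergy_of_nash` carries the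
window binder `hin : ∀ x ∈ a, ‖x‖ + τ ≤ Rc`, which forces the label template to STOP inside the window; clause 2 of `coherentAt` (no atom of `B̄(Rc)`
outside the template tubes) then makes the rows uninhabited by perturbed full lattices.  The repair of record is the `hin`-FREE door (362)
`…CoherentFloorComplete.certFloor_le_two_mul_rootEnergy_of_nash'` over COMPLETE templates (tubes may straddle or pass the window sphere).  This file
re-threads the three generic class-A wrappers of the K-file tower through the primed door, ADDITIVELY (new names, no landed statement edited):

* `certFloorL_le_two_mul_rootEnergy_of_nash'` — (CellFrame) T2 in the label frame, `hin` deleted;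
* `rowFloor_of_cells'` — (CellFrame) row packaging for the atlas door, `hin` deleted;
* `rowFloor_of_nearIdBox'` — (260, CellData) near-identity strain box, `hin` AND its scaffolding `hRcτ` deleted;
* `rowFloor_of_gramBox'` — (CellAdmissible) metric box, `hin`/`hRcτ` deleted.
Everything else (separation, interior inset `hI`, certification `hcert`) is verbatim; the proofs are the tree's with the one call swapped.  The F1 row
of record over the COMPLETE label set `MF1c` (amendment E2/E4) then calls `rowFloor_of_nearIdBox'` exactly as #93 `row_F1` called (260).
Imports TREE (362) `…CoherentFloorComplete` + `…CellData`; 0 defs; 0 sorry.  Tags: [folklore: bookkeeping]; nothing here closes an item.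
-/

noncomputable section

namespace Summit.AtomisticToContinuum.Crystallization.Theorems.FrustratedLawDichotomyCellFrameComplete

open MeasureTheory Metric Set RealInnerProductSpace
open scoped BigOperators
open Literature.MathematicalPhysics.StatisticalMechanics (lennardJones rootEnergy)
open Literature.Probability.Process (IsRootedHardCore)
open Summit.AtomisticToContinuum.Crystallization.Theorems.ChargedEnergyGapNegative (E3)
open Summit.AtomisticToContinuum.Crystallization.Theorems.FrustratedLawDichotomyCoherentSets (coherentAt)
open Summit.AtomisticToContinuum.Crystallization.Theorems.FrustratedLawDichotomyCoherentFloorAlgebra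
open Summit.AtomisticToContinuum.Crystallization.Theorems.FrustratedLawDichotomyCoherentFloor
open Summit.AtomisticToContinuum.Crystallization.Theorems.FrustratedLawDichotomyCoherentFloorComplete (certFloor_le_two_mul_rootEnergy_of_nash')
open Summit.AtomisticToContinuum.Crystallization.Theorems.FrustratedLawDichotomyCellFrame
open Summit.AtomisticToContinuum.Crystallization.Theorems.FrustratedLawDichotomyCellMetric
open Summit.AtomisticToContinuum.Crystallization.Theorems.FrustratedLawDichotomyCellAdmissible
open Summit.AtomisticToContinuum.Crystallization.Theorems.FrustratedLawDichotomyCellData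

variable {ι : Type*} [DecidableEq ι]

/-- ★★ **T2 IN THE LABEL FRAME, COMPLETE TEMPLATES** (the tree's `certFloorL_le_two_mul_rootEnergy_of_nash` with the window binder `hin` deleted):
for a rooted `7/10`-hard-core Nash `μ` coherent with the placed template `M.image pos` (`pos o = 0`, `MI ⊆ M`, placed labels `2τ`-separated, interior
labels `7/20` inside the window), `certFloorL M MI o pos Y τ Rc ≤ 2·rootEnergy V_LJ μ` for ANY label multipliers `Y`. [folklore] -/
theorem certFloorL_le_two_mul_rootEnergy_of_nash' {μ : Measure E3} {τ Rc : ℝ} (M MI : Finset ι) (o : ι) (pos Y : ι → E3)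
    (hμ : IsRootedHardCore (7 / 10) μ)
    (hNash : ∀ p : E3, μ {p} ≠ 0 → ∀ w : E3, (∀ q : E3, μ {q} ≠ 0 → q ≠ p → w ≠ q) →
      ∑' q : {q : E3 // μ {q} ≠ 0 ∧ q ≠ p}, lennardJones (dist p (q : E3)) ≤
        ∑' q : {q : E3 // μ {q} ≠ 0 ∧ q ≠ p}, lennardJones (dist w (q : E3)))
    (hτ0 : 0 ≤ τ) (hτ : 2 * τ < 7 / 10) (hRc : 1 ≤ Rc) (hcoh : μ ∈ coherentAt (M.image pos) τ Rc)
    (ho : o ∈ M) (h0 : pos o = 0) (hMI : MI ⊆ M)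
    (hsep : ∀ m ∈ M, ∀ m' ∈ M, m ≠ m' → 2 * τ < dist (pos m) (pos m'))
    (hI : ∀ m ∈ MI, 7 / 20 ≤ Rc - (‖pos m‖ + τ)) :
    certFloorL M MI o pos Y τ Rc ≤ 2 * rootEnergy lennardJones μ := by
  classical
  have hinj : Set.InjOn pos ↑M := by
    intro m hm m' hm' h
    by_contra hne
    have h1 := hsep m hm m' hm' hne
    rw [h, dist_self] at h1
    linarith
  rw [← certFloor_image_eq hinj ho h0 hMI]
  refine certFloor_le_two_mul_rootEnergy_of_nash' _ hμ hNash hτ0 hτ hRc hcoh (Finset.mem_image.2 ⟨o, ho, h0⟩)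
    (Finset.image_subset_image hMI) ?_ ?_
  · intro x hx x' hx' hne
    obtain ⟨m, hm, rfl⟩ := Finset.mem_image.1 hx
    obtain ⟨m', hm', rfl⟩ := Finset.mem_image.1 hx'
    exact hsep m hm m' hm' fun h => hne (by rw [h])
  · intro x hx
    obtain ⟨m, hm, rfl⟩ := Finset.mem_image.1 hx
    exact hI m hm

/-- ★ **ROW PACKAGING FOR THE ATLAS DOOR, COMPLETE TEMPLATES** (the tree's `rowFloor_of_cells` with `hin` deleted): a family of admissible (root at
`0`, `2τ`-separated, interior `7/20` inside) and CERTIFIED placements over a parameter set `B` gives `c + mc ≤ rootEnergy` on the row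
`⋃_{F ∈ B} coherentAt (M.image (posF F)) τ Rc` at every rooted `7/10`-hard-core Nash configuration. [folklore] -/
theorem rowFloor_of_cells' {κ : Type*} (B : Set κ) (M MI : Finset ι) (o : ι) (posF YF : κ → ι → E3) {τ Rc c mc : ℝ}
    (hτ0 : 0 ≤ τ) (hτ : 2 * τ < 7 / 10) (hRc : 1 ≤ Rc) (ho : o ∈ M) (hMI : MI ⊆ M)
    (h0 : ∀ F ∈ B, posF F o = 0)
    (hsep : ∀ F ∈ B, ∀ m ∈ M, ∀ m' ∈ M, m ≠ m' → 2 * τ < dist (posF F m) (posF F m'))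
    (hI : ∀ F ∈ B, ∀ m ∈ MI, 7 / 20 ≤ Rc - (‖posF F m‖ + τ))
    {cUp : ℝ} (hc : c ≤ cUp) (hcert : ∀ F ∈ B, 2 * (cUp + mc) ≤ certFloorL M MI o (posF F) (YF F) τ Rc)
    (μ : Measure E3) (hμ : IsRootedHardCore (7 / 10) μ)
    (hNash : ∀ p : E3, μ {p} ≠ 0 → ∀ w : E3, (∀ q : E3, μ {q} ≠ 0 → q ≠ p → w ≠ q) →
      ∑' q : {q : E3 // μ {q} ≠ 0 ∧ q ≠ p}, lennardJones (dist p (q : E3)) ≤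
        ∑' q : {q : E3 // μ {q} ≠ 0 ∧ q ≠ p}, lennardJones (dist w (q : E3)))
    (hrow : μ ∈ ⋃ F ∈ B, coherentAt (M.image (posF F)) τ Rc) :
    c + mc ≤ rootEnergy lennardJones μ := by
  obtain ⟨F, hF, hcoh⟩ := Set.mem_iUnion₂.1 hrow
  have h := certFloorL_le_two_mul_rootEnergy_of_nash' M MI o (posF F) (YF F) hμ hNash hτ0 hτ hRc hcoh ho (h0 F hF) hMI (hsep F hF) (hI F hF)
  linarith [hcert F hF]

/-- ★★ **(260′) ROW FLOOR OF A NEAR-IDENTITY STRAIN-BOX CELL, COMPLETE TEMPLATES** (the tree's `rowFloor_of_nearIdBox` with `hRcτ`/`hin` deleted):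
Cartesian template `a` (`a o = 0`), cell matrices with `|FᵀF − 1| ≤ ε`, template facts `(2τ)² < (1 − 3ε)|a m − a m'|²` (pairs) and
`(1 + 3ε)|a m|² ≤ (Rc − τ − 7/20)²` (interior), certified placements ⇒ the row floor. [folklore] -/
theorem rowFloor_of_nearIdBox' (ε : ℝ) (B : Set (Matrix (Fin 3) (Fin 3) ℝ))
    (hB : ∀ F ∈ B, ∀ i j, |(F.transpose * F) i j - (if i = j then 1 else 0)| ≤ ε)
    (M MI : Finset ι) (o : ι) (a : ι → Fin 3 → ℝ) (YF : Matrix (Fin 3) (Fin 3) ℝ → ι → E3) {τ Rc c mc : ℝ}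
    (hτ0 : 0 ≤ τ) (hτ : 2 * τ < 7 / 10) (hRc : 1 ≤ Rc) (ho : o ∈ M) (hMI : MI ⊆ M) (ha0 : a o = 0)
    (hsep : ∀ m ∈ M, ∀ m' ∈ M, m ≠ m' → (2 * τ) ^ 2 < (1 - 3 * ε) * ∑ i, (a m i - a m' i) ^ 2)
    (hRcI : 0 ≤ Rc - τ - 7 / 20) (hI : ∀ m ∈ MI, (1 + 3 * ε) * ∑ i, a m i ^ 2 ≤ (Rc - τ - 7 / 20) ^ 2)
    {cUp : ℝ} (hc : c ≤ cUp) (hcert : ∀ F ∈ B, 2 * (cUp + mc) ≤ certFloorL M MI o (fun m => posL F (a m)) (YF F) τ Rc)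
    (μ : Measure E3) (hμ : IsRootedHardCore (7 / 10) μ)
    (hNash : ∀ p : E3, μ {p} ≠ 0 → ∀ w : E3, (∀ q : E3, μ {q} ≠ 0 → q ≠ p → w ≠ q) →
      ∑' q : {q : E3 // μ {q} ≠ 0 ∧ q ≠ p}, lennardJones (dist p (q : E3)) ≤
        ∑' q : {q : E3 // μ {q} ≠ 0 ∧ q ≠ p}, lennardJones (dist w (q : E3)))
    (hrow : μ ∈ ⋃ F ∈ B, coherentAt (M.image fun m => posL F (a m)) τ Rc) :
    c + mc ≤ rootEnergy lennardJones μ := by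
  refine rowFloor_of_cells' B M MI o (fun F m => posL F (a m)) YF hτ0 hτ hRc ho hMI ?_ ?_ ?_ hc hcert μ hμ hNash hrow
  · intro F _
    show posL F (a o) = 0
    rw [ha0, posL_zero]
  · intro F hF m hm m' hm' hne
    exact lt_dist_of_nearId (hB F hF) (hsep m hm m' hm' hne)
  · intro F hF m hm
    exact inset_of_nearId (hB F hF) hRcI (hI m hm)

/-- ★★ **ROW FLOOR OF A METRIC-BOX CELL, COMPLETE TEMPLATES** (the tree's `rowFloor_of_gramBox` with `hRcτ`/`hin` deleted): metric box
`Glo ≤ FᵀF ≤ Ghi`, rational corner facts for pairs and the interior, certified placements ⇒ the row floor. [folklore] -/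
theorem rowFloor_of_gramBox' (Glo Ghi : Matrix (Fin 3) (Fin 3) ℝ) (B : Set (Matrix (Fin 3) (Fin 3) ℝ))
    (hB : ∀ F ∈ B, (∀ i j, Glo i j ≤ (F.transpose * F) i j) ∧ ∀ i j, (F.transpose * F) i j ≤ Ghi i j)
    (M MI : Finset ι) (o : ι) (a : ι → Fin 3 → ℝ) (YF : Matrix (Fin 3) (Fin 3) ℝ → ι → E3) {τ Rc c mc : ℝ}
    (hτ0 : 0 ≤ τ) (hτ : 2 * τ < 7 / 10) (hRc : 1 ≤ Rc) (ho : o ∈ M) (hMI : MI ⊆ M) (ha0 : a o = 0)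
    (hsep : ∀ m ∈ M, ∀ m' ∈ M, m ≠ m' → (2 * τ) ^ 2 < gramLo Glo Ghi (a m - a m') (a m - a m'))
    (hRcI : 0 ≤ Rc - τ - 7 / 20) (hI : ∀ m ∈ MI, gramHi Glo Ghi (a m) (a m) ≤ (Rc - τ - 7 / 20) ^ 2)
    {cUp : ℝ} (hc : c ≤ cUp) (hcert : ∀ F ∈ B, 2 * (cUp + mc) ≤ certFloorL M MI o (fun m => posL F (a m)) (YF F) τ Rc)
    (μ : Measure E3) (hμ : IsRootedHardCore (7 / 10) μ)
    (hNash : ∀ p : E3, μ {p} ≠ 0 → ∀ w : E3, (∀ q : E3, μ {q} ≠ 0 → q ≠ p → w ≠ q) →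
      ∑' q : {q : E3 // μ {q} ≠ 0 ∧ q ≠ p}, lennardJones (dist p (q : E3)) ≤
        ∑' q : {q : E3 // μ {q} ≠ 0 ∧ q ≠ p}, lennardJones (dist w (q : E3)))
    (hrow : μ ∈ ⋃ F ∈ B, coherentAt (M.image fun m => posL F (a m)) τ Rc) :
    c + mc ≤ rootEnergy lennardJones μ := by
  refine rowFloor_of_cells' B M MI o (fun F m => posL F (a m)) YF hτ0 hτ hRc ho hMI ?_ ?_ ?_ hc hcert μ hμ hNash hrow
  · intro F _
    show posL F (a o) = 0
    rw [ha0, posL_zero]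
  · intro F hF m hm m' hm' hne
    exact sep_of_gramLo (hB F hF).1 (hB F hF).2 (hsep m hm m' hm' hne)
  · intro F hF m hm
    exact inset_of_gramHi (hB F hF).1 (hB F hF).2 hRcI (hI m hm)

end Summit.AtomisticToContinuum.Crystallization.Theorems.FrustratedLawDichotomyCellFrameComplete

end
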